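import Literature.Barriers.AtomisticToContinuum.HardDiskTranslationInvarianceSteps
import Mathlib.MeasureTheory.Measure.Haar.InnerProductSpace
import Mathlib.MeasureTheory.Measure.Lebesgue.Basic
import HarnessLib

/-!
# The maximum norm and the volumes of the boxes `Λ_r` (Richthammer 2007, §3.1)

Companion of `HardDiskTranslationInvarianceSteps.lean` (provefact
`Literature.Barriers.AtomisticToContinuum.HardDisk.Richthammer2007_hardDisk`): planar geometry
shared by the cluster bounds (§6.1) and the bad-configuration estimates (§6.8). "On `ℝ²` we
consider the maximum norm `|.|` and the Euclidean norm `|.|₂`" [Richthammer2007, §3.1]; the boxes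
`Λ_r = [-r, r[²` are the tree's `box r`.

* `supNorm y = |y|` (the sup norm of the coordinate vector) with `abs_apply_le_supNorm`,
  `supNorm_le_of_forall`, `supNorm_le_norm` (`|y| ≤ |y|₂`), `supNorm_sub_le` (triangle
  inequality), `supNorm_le_of_mem_box`, `mem_box_of_supNorm_lt`, `continuous_supNorm`;
* `volume_setOf_supNorm_lt` — `λ²{|x| < s} = (2s)²`, `volume_box_le` — `λ²(Λ_r) ≤ (2r)²`
  (in fact equality; the bound is what §6.1/§6.8 use, "`λ²(Λ_{n'}) = (2n')²`").

## References

* [Richthammer2007] T. Richthammer, *Translation-invariance of two-dimensional Gibbsian point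
  processes*, Comm. Math. Phys. 274 (2007) 81–122, arXiv:0706.3637: §3.1 (p. 5), §6.1 (p. 13).
-/

noncomputable section

open MeasureTheory Set
open scoped ENNReal

namespace Literature.Barriers.AtomisticToContinuum.HardDisk

/-- The plane. -/
local notation "E2" => EuclideanSpace ℝ (Fin 2)

/-! ### The maximum norm -/

/-- The maximum norm `|y| = max(|y₁|, |y₂|)` on `ℝ²` (Richthammer 2007, §3.1: "on `ℝ²` we
consider the maximum norm `|.|`"), as the sup norm of the coordinate vector.
[cite: Richthammer2007, §3.1 (p. 5)] -/
def supNorm (y : E2) : ℝ := ‖(WithLp.ofLp y : Fin 2 → ℝ)‖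

/-- Coordinates are bounded by the maximum norm. [folklore] -/
theorem abs_apply_le_supNorm (y : E2) (i : Fin 2) : |y i| ≤ supNorm y := by
  have h := norm_le_pi_norm (WithLp.ofLp y : Fin 2 → ℝ) i
  rwa [Real.norm_eq_abs] at h

/-- The maximum norm is bounded by the coordinates. [folklore] -/
theorem supNorm_le_of_forall {y : E2} {r : ℝ} (hr : 0 ≤ r) (h : ∀ i, |y i| ≤ r) : supNorm y ≤ r :=
  (pi_norm_le_iff_of_nonneg hr).2 fun i => by rw [Real.norm_eq_abs]; exact h i

/-- The maximum norm is nonnegative. [folklore] -/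
theorem supNorm_nonneg (y : E2) : 0 ≤ supNorm y := norm_nonneg _

/-- The maximum norm is dominated by the Euclidean norm. [folklore] -/
theorem supNorm_le_norm (y : E2) : supNorm y ≤ ‖y‖ := by
  refine supNorm_le_of_forall (norm_nonneg y) fun i => ?_
  rw [EuclideanSpace.norm_eq]
  have hi : |y i| ^ 2 ≤ ∑ j : Fin 2, ‖y j‖ ^ 2 := by
    rw [← Real.norm_eq_abs]
    exact Finset.single_le_sum (f := fun j => ‖y j‖ ^ 2) (fun j _ => sq_nonneg _) (Finset.mem_univ i)
  calc |y i| = Real.sqrt (|y i| ^ 2) := (Real.sqrt_sq (abs_nonneg _)).symm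
    _ ≤ Real.sqrt (∑ j : Fin 2, ‖y j‖ ^ 2) := Real.sqrt_le_sqrt hi

/-- Triangle inequality for the maximum norm. [folklore] -/
theorem supNorm_sub_le (a b : E2) : supNorm a ≤ supNorm b + supNorm (a - b) := by
  unfold supNorm
  rw [WithLp.ofLp_sub]
  exact norm_le_insert' _ _

/-- Points of `Λ_r` have maximum norm at most `r`. [folklore] -/
theorem supNorm_le_of_mem_box {r : ℝ} (hr : 0 ≤ r) {y : E2} (hy : y ∈ box r) : supNorm y ≤ r :=
  supNorm_le_of_forall hr fun i => abs_le.2 ⟨(hy i).1, (hy i).2.le⟩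

/-- Points of maximum norm `< r` lie in `Λ_r`. [folklore] -/
theorem mem_box_of_supNorm_lt {r : ℝ} {y : E2} (hy : supNorm y < r) : y ∈ box r := fun i => by
  have h := lt_of_le_of_lt (abs_apply_le_supNorm y i) hy
  exact ⟨(abs_lt.1 h).1.le, (abs_lt.1 h).2⟩

/-- Points of `Λ_r` have maximum norm `≤ r`, points outside have maximum norm `≥ r`. [folklore] -/
theorem le_supNorm_of_notMem_box {r : ℝ} {y : E2} (hy : y ∉ box r) : r ≤ supNorm y :=
  le_of_not_gt fun h => hy (mem_box_of_supNorm_lt h)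

/-- The maximum norm is continuous. [folklore] -/
theorem continuous_supNorm : Continuous supNorm :=
  continuous_norm.comp (PiLp.continuous_ofLp 2 _)

/-- The maximum norm is measurable. [folklore] -/
theorem measurable_supNorm : Measurable supNorm := continuous_supNorm.measurable

/-! ### Volumes -/

/-- `{|x| < s}` is the preimage of the sup-norm ball of `ℝ²`. [folklore] -/
theorem setOf_supNorm_lt_eq (s : ℝ) :
    {x : E2 | supNorm x < s} = (WithLp.ofLp : E2 → Fin 2 → ℝ) ⁻¹' Metric.ball 0 s := by
  ext x
  simp [supNorm]

/-- **`λ²{|x| < s} = (2s)²`** for `s > 0`. [folklore] -/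
theorem volume_setOf_supNorm_lt {s : ℝ} (hs : 0 < s) :
    volume {x : E2 | supNorm x < s} = ENNReal.ofReal ((2 * s) ^ 2) := by
  rw [setOf_supNorm_lt_eq, (PiLp.volume_preserving_ofLp (Fin 2)).measure_preimage
    measurableSet_ball.nullMeasurableSet, Real.volume_pi_ball _ hs, Fintype.card_fin]

/-- `{|x| < s}` is measurable. [folklore] -/
theorem measurableSet_setOf_supNorm_lt (s : ℝ) : MeasurableSet {x : E2 | supNorm x < s} :=
  measurableSet_lt measurable_supNorm measurable_const

/-- `Λ_r ⊆ {|x| < s}` for `r < s`. [folklore] -/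
theorem box_subset_setOf_supNorm_lt {r s : ℝ} (hr : 0 ≤ r) (hrs : r < s) :
    box r ⊆ {x : E2 | supNorm x < s} := fun _ hx => lt_of_le_of_lt (supNorm_le_of_mem_box hr hx) hrs

/-- **`λ²(Λ_r) ≤ (2r)²`** (`r ≥ 0`; in fact equality, "`λ²(Λ_{n'}) = (2n')²`", §6.1).
[cite: Richthammer2007, §6.1 (p. 13)] -/
theorem volume_box_le {r : ℝ} (hr : 0 ≤ r) : volume (box r) ≤ ENNReal.ofReal ((2 * r) ^ 2) := by
  -- `Λ_r ⊆ {|x| < r + δ}` for every `δ > 0`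
  refine ENNReal.le_of_forall_pos_le_add fun δ hδ _ => ?_
  have hδ' : (0 : ℝ) < δ := by exact_mod_cast hδ
  -- choose `η > 0` with `(2(r+η))² ≤ (2r)² + δ`
  obtain ⟨η, hη0, hη⟩ : ∃ η : ℝ, 0 < η ∧ (2 * (r + η)) ^ 2 ≤ (2 * r) ^ 2 + δ := by
    refine ⟨min 1 (δ / (8 * r + 4)), lt_min one_pos (div_pos hδ' (by positivity)), ?_⟩
    set η : ℝ := min 1 (δ / (8 * r + 4)) with hηdef
    have h1 : η ≤ 1 := min_le_left _ _
    have h2 : η ≤ δ / (8 * r + 4) := min_le_right _ _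
    have h3 : 0 ≤ η := le_min zero_le_one (div_nonneg hδ'.le (by positivity))
    have h4 : η * (8 * r + 4) ≤ δ := by rwa [le_div_iff₀ (by positivity)] at h2
    nlinarith
  calc volume (box r) ≤ volume {x : E2 | supNorm x < r + η} :=
        measure_mono (box_subset_setOf_supNorm_lt hr (by linarith))
    _ = ENNReal.ofReal ((2 * (r + η)) ^ 2) := volume_setOf_supNorm_lt (by linarith)
    _ ≤ ENNReal.ofReal ((2 * r) ^ 2 + δ) := ENNReal.ofReal_le_ofReal hη
    _ = ENNReal.ofReal ((2 * r) ^ 2) + (δ : ℝ≥0∞) := by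
        rw [ENNReal.ofReal_add (by positivity) hδ'.le, ENNReal.ofReal_coe_nnreal]

end Literature.Barriers.AtomisticToContinuum.HardDisk

end
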